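import Summits.ResolutionOfSingularities.ResolutionOfSingularities.Theorems.FrobeniusLadderFInjectiveMacaulayficationCIPolyKitCert
import HarnessLib

/-!
# CI POLY KIT, part 3 — torus (cell) certificates: the `S = ∅` case of `hcert_two_of_lists` without the identity substitution
# (crux `FInjectiveMacaulayfication`, CI-CN engine, K-T4 Lean half: idea-1's LAYER-A weight-cell tables; seat res-L1-w45a-stub-6)

Support file for crux stmt-ResolutionOfSingularities-15315. [OURS · L1 W4.5a] — NOT a statement of the manuscript; AI-written, weaker
than expert review.

`hcert_two_torus_of_lists`: for two polynomials given as term lists `G 0, G 1` (e.g. the `w`-initial forms `in_w F₁, in_w F₂` of a weight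
cell), an exponent `e`, column choices and cofactor lists, ONE `decide`-able congruence gives
`X^e ∈ (g₀, g₁) + (det(∂_{cols μ i} g_l))_μ` in `K[X]` — Khovanskii non-degeneracy of the cell («the initial complete intersection is
smooth of codimension 2 on the torus, or empty») in certificate form. (`hcert_two_of_lists` with `S = ∅`, the substitution
`Xᵢ ↦ Xᵢ` removed by `aeval_X_left`.) No definition is declared. [folklore]
-/

-- single-problem summit: the doubled namespace component is forced
set_option linter.dupNamespace false

noncomputable section

namespace Summit.ResolutionOfSingularities.ResolutionOfSingularities.Theorems.FInjectiveMacaulayfication.CIPolyKitCells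

open MvPolynomial
open Summit.ResolutionOfSingularities.ResolutionOfSingularities.Theorems.FInjectiveMacaulayfication

variable {K : Type} [CommRing K] {n : ℕ}

/-- The substitution `Xᵢ ↦ (if i ∈ ∅ then 0 else Xᵢ)` is the identity. [folklore] -/
theorem aeval_substZero_empty (q : MvPolynomial (Fin n) K) :
    aeval (fun i : Fin n => if i ∈ (∅ : Finset (Fin n)) then (0 : MvPolynomial (Fin n) K) else X i) q = q := by
  have h : (fun i : Fin n => if i ∈ (∅ : Finset (Fin n)) then (0 : MvPolynomial (Fin n) K) else X i) = X := by
    funext i; simp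
  rw [h, aeval_X_left_apply]

/-- **TORUS (CELL) CERTIFICATE OF A TWO-EQUATION COMPLETE INTERSECTION FROM LIST DATA**: `X^e ∈ (g₀, g₁) + (2×2 coordinate minors)`
from one `decide`-able congruence of integer coefficient sums (`CIPolyKitCert.hcert_two_of_lists` at `S = ∅`). [folklore] -/
theorem hcert_two_torus_of_lists (p : ℕ) [CharP K p] (G : Fin 2 → List (ℤ × (Fin n → ℕ)))
    (e : Fin n → ℕ) (t : ℕ) (cols : Fin t → Fin 2 → Fin n)
    (A : Fin 2 → List (ℤ × (Fin n → ℕ))) (B : Fin t → List (ℤ × (Fin n → ℕ)))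
    (hcheck :
      let GS : Fin 2 → List (ℤ × (Fin n → ℕ)) := fun l => (G l).filter fun t => ∀ i ∈ (∅ : Finset (Fin n)), t.2 i = 0
      let pd : Fin n → List (ℤ × (Fin n → ℕ)) → List (ℤ × (Fin n → ℕ)) := fun j L =>
        L.map fun t => (t.1 * (t.2 j : ℤ), Function.update t.2 j (t.2 j - 1))
      let mul : List (ℤ × (Fin n → ℕ)) → List (ℤ × (Fin n → ℕ)) → List (ℤ × (Fin n → ℕ)) := fun L₁ L₂ =>
        L₁.flatMap fun s => L₂.map fun t => (s.1 * t.1, s.2 + t.2)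
      let neg : List (ℤ × (Fin n → ℕ)) → List (ℤ × (Fin n → ℕ)) := fun L => L.map fun t => (-t.1, t.2)
      let DET : Fin t → List (ℤ × (Fin n → ℕ)) := fun μ =>
        mul (pd (cols μ 0) (GS 0)) (pd (cols μ 1) (GS 1)) ++ neg (mul (pd (cols μ 0) (GS 1)) (pd (cols μ 1) (GS 0)))
      let RHS : List (ℤ × (Fin n → ℕ)) :=
        (List.finRange 2).flatMap (fun l => mul (A l) (GS l)) ++ (List.finRange t).flatMap (fun μ => mul (B μ) (DET μ))
      ∀ v ∈ e :: RHS.map (fun t => t.2),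
        (p : ℤ) ∣ (([((1 : ℤ), e)].filter fun t : ℤ × (Fin n → ℕ) => t.2 = v).map (fun t => t.1)).sum -
          ((RHS.filter fun t : ℤ × (Fin n → ℕ) => t.2 = v).map (fun t => t.1)).sum) :
    (monomial (Finsupp.equivFunOnFinite.symm e) (1 : K) : MvPolynomial (Fin n) K) ∈
      Ideal.span (Set.range fun l : Fin 2 =>
          ((G l).map fun t : ℤ × (Fin n → ℕ) =>
            (monomial (Finsupp.equivFunOnFinite.symm t.2) ((t.1 : ℤ) : K) : MvPolynomial (Fin n) K)).sum) ⊔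
        Ideal.span (Set.range fun μ : Fin t => (Matrix.of fun i l => pderiv (cols μ i)
          (((G l).map fun t : ℤ × (Fin n → ℕ) =>
            (monomial (Finsupp.equivFunOnFinite.symm t.2) ((t.1 : ℤ) : K) : MvPolynomial (Fin n) K)).sum)).det) := by
  have h := CIPolyKitCert.hcert_two_of_lists (K := K) p G ∅ e t cols A B hcheck
  simp only [aeval_substZero_empty] at h
  exact h

end Summit.ResolutionOfSingularities.ResolutionOfSingularities.Theorems.FInjectiveMacaulayfication.CIPolyKitCells

end
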